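import Mathlib
import Summits.ValiantsHypothesis.ValiantsHypothesis.Theorems.RigidityForcesSymmetryRankRigidMinimalReprLaplaceFiveSeparatedCaptureK1Bridge
import Summits.ValiantsHypothesis.ValiantsHypothesis.Theorems.RigidityForcesSymmetryRankRigidMinimalReprLaplaceFiveSeparatedCaptureTwoEqualPlusLineSpans
import Summits.ValiantsHypothesis.ValiantsHypothesis.Theorems.RigidityForcesSymmetryRankRigidMinimalReprLaplaceFiveSeparatedCaptureCommonLineDiag
import Summits.ValiantsHypothesis.ValiantsHypothesis.Theorems.RigidityForcesSymmetryRankRigidMinimalReprLaplaceFiveSeparatedCaptureCommonLineThreeRows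
import Summits.ValiantsHypothesis.ValiantsHypothesis.Theorems.RigidityForcesSymmetryRankRigidMinimalReprLaplaceFiveSeparatedCaptureCommonLinePairMonomial

/-!
# ValiantsHypothesis / RigidityForcesSymmetry — crux `LaplaceOptimalFive` (stmt-ValiantsHypothesis-24813), symmetric capture:
# ★★★★ **`CaptureIneqSym` FOR THREE 2-PLANES THROUGH ANY COMMON LINE** (the common-line profile, assembled)

Brick 3 (part 12) of the K1 lane (val-port-2 g6, 2026-08-29).  Trichotomy on the nonzero symmetric common line `u`: a diagonal entry
(✓ `finrank_le_six_of_common_line_diag`), zero diagonal with a third nonzero row (✓ `finrank_le_six_of_common_line_three_rows`), or — all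
entries off one pair `{i,j}` and the diagonal vanish — a pair monomial (✓ `finrank_le_six_of_common_line_pair`).  No census, no
prolongation or flatness hypothesis: the only side conditions are the profile's (`a ∉ ⟨u,b⟩`, `a ∉ ⟨u,c⟩`, i.e. the first plane differs
from the other two; the case of two equal planes is ✓ `finrank_le_six_of_two_equal_plus_line`).

* ★★★★ `finrank_le_six_of_common_line`, ★★★★ `captureIneqSym_of_common_line` (generator form);
* ★★★★ `captureIneqSym_of_common_line_planes` — submodule form: `P, Q, R` symmetric of finrank ≤ 2, `P ⊓ Q ⊓ R ≠ ⊥`, `P ≰ Q`, `P ≰ R`,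
  `6 ≤ Σ finrank` ⇒ `finrank W ≤ finrank P + finrank Q + finrank R` (generators via ✓ `eq_span_pair_of_finrank_le_two`);
* ★★★ `sideSym_K32canon_common_line` — the K1 wrapper on `K₃ ⊔ K₂` (✓ `sideSym_K32canon_of_captureAt`): three short-span planes sharing a
  line ⇒ Laplace weight `≥ 5!`.

Honest framing.  This settles the common-line profile of `CaptureIneqSym` (three symmetric 2-planes sharing a line).  Profiles with a
span of finrank ≥ 3 outside the landed cells, `CaptureIneqSym` in general, K1 on `K₃ ⊔ K₂`, `LaplaceOptimalFive` (OPEN · CONTESTED 72/120),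
`RankRigidMinimalRepr` and `VP ≠ VNP` are NOT proved here.  No definitions, no `sorry`.
-/

set_option linter.dupNamespace false
set_option autoImplicit false

namespace Summit.ValiantsHypothesis.ValiantsHypothesis.Theorems.RigidityForcesSymmetryRankRigidMinimalRepr

namespace LaplaceFiveSeparatedCapture

open Finset LaplaceFiveSectorSplit

/-- ★★★★ **`CaptureIneqSym` FOR THREE 2-PLANES THROUGH ANY COMMON LINE: `finrank W ≤ 6`.**  `u ≠ 0`, `a, b, c` symmetric with
`a ∉ ⟨u,b⟩`, `a ∉ ⟨u,c⟩`; every `W` of symmetric zero-diagonal leaf matrices captured by `L3 ⟨u,a⟩ ⟨u,b⟩ ⟨u,c⟩` has `finrank W ≤ 6`.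
Trichotomy on `u`: a diagonal entry (✓ `finrank_le_six_of_common_line_diag`), zero diagonal with three nonzero rows
(✓ `finrank_le_six_of_common_line_three_rows`), or a pair monomial (✓ `finrank_le_six_of_common_line_pair`). [folklore] -/
theorem finrank_le_six_of_common_line (u a b c : Fin 5 → Fin 5 → ℂ) (hu : ∀ p q, u p q = u q p)
    (ha : ∀ p q, a p q = a q p) (hb : ∀ p q, b p q = b q p) (hc : ∀ p q, c p q = c q p) (hu0 : u ≠ 0)
    (hab : a ∉ Submodule.span ℂ ({u, b} : Set (Fin 5 → Fin 5 → ℂ))) (hac : a ∉ Submodule.span ℂ ({u, c} : Set (Fin 5 → Fin 5 → ℂ)))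
    (W : Submodule ℂ (Fin 5 → Fin 5 → ℂ))
    (hWs : ∀ μ ∈ W, ∀ s t : Fin 5, μ s t = μ t s) (hWd : ∀ μ ∈ W, ∀ s : Fin 5, μ s s = 0)
    (hWc : ∀ μ ∈ W, contractZ μ ∈ L3 (Submodule.span ℂ ({u, a} : Set (Fin 5 → Fin 5 → ℂ)))
      (Submodule.span ℂ ({u, b} : Set (Fin 5 → Fin 5 → ℂ))) (Submodule.span ℂ ({u, c} : Set (Fin 5 → Fin 5 → ℂ)))) :
    Module.finrank ℂ W ≤ 6 := by
  classical
  have hsym2 : ∀ v : Fin 5 → Fin 5 → ℂ, (∀ p q, v p q = v q p) →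
      ∀ x ∈ Submodule.span ℂ ({u, v} : Set (Fin 5 → Fin 5 → ℂ)), ∀ p q : Fin 5, x p q = x q p := by
    intro v hv x hx p q
    obtain ⟨c1, c2, rfl⟩ := Submodule.mem_span_pair.mp hx
    simp only [Pi.add_apply, Pi.smul_apply, smul_eq_mul, hu p q, hv p q]
  have h2 : ∀ v : Fin 5 → Fin 5 → ℂ, Module.finrank ℂ (Submodule.span ℂ ({u, v} : Set (Fin 5 → Fin 5 → ℂ))) ≤ 2 := by
    intro v
    have h : Module.finrank ℂ (Submodule.span ℂ (↑({u, v} : Finset (Fin 5 → Fin 5 → ℂ)) : Set (Fin 5 → Fin 5 → ℂ))) ≤ 2 :=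
      (finrank_span_finset_le_card _).trans Finset.card_le_two
    have hset : (↑({u, v} : Finset (Fin 5 → Fin 5 → ℂ)) : Set (Fin 5 → Fin 5 → ℂ)) = {u, v} := by
      simp only [Finset.coe_insert, Finset.coe_singleton]
    rw [hset] at h
    exact h
  have humem : ∀ v : Fin 5 → Fin 5 → ℂ, u ∈ Submodule.span ℂ ({u, v} : Set (Fin 5 → Fin 5 → ℂ)) :=
    fun v => Submodule.subset_span (by simp)
  -- (1) a diagonal entry
  by_cases hdiag : ∃ q, u q q ≠ 0
  · obtain ⟨q, hq⟩ := hdiag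
    exact finrank_le_six_of_common_line_diag u a hu ha q hq _ _ W (hsym2 b hb) (hsym2 c hc) (humem b) (humem c) hab
      (h2 b) (h2 c) hWs hWd hWc
  push Not at hdiag
  -- an off-diagonal entry `u i j ≠ 0`
  have hij : ∃ i j, u i j ≠ 0 := by
    by_contra h
    push Not at h
    exact hu0 (funext fun i => funext fun j => h i j)
  obtain ⟨i, j, huij⟩ := hij
  have hij : i ≠ j := fun h => huij (by rw [h]; exact hdiag j)
  -- (2) a third nonzero row, or (3) a pair monomial
  by_cases hthird : ∃ p r, p ≠ i ∧ p ≠ j ∧ u p r ≠ 0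
  · obtain ⟨p, r, hpi, hpj, hupr⟩ := hthird
    exact finrank_le_six_of_common_line_three_rows u a b c hu ha hb hc i j p r hij hpi hpj huij hupr hdiag hab hac W hWs hWd hWc
  · push Not at hthird
    have hoff : ∀ p q : Fin 5, u p q ≠ 0 → (p = i ∧ q = j) ∨ (p = j ∧ q = i) := by
      intro p q hpq
      have hp : p = i ∨ p = j := by
        by_contra h
        push Not at h
        exact hpq (hthird p q h.1 h.2)
      have hq : q = i ∨ q = j := by
        by_contra h
        push Not at h
        exact hpq (by rw [hu p q]; exact hthird q p h.1 h.2)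
      rcases hp with hp | hp <;> rcases hq with hq | hq
      · exact absurd (by rw [hp, hq]; exact hdiag i) hpq
      · exact Or.inl ⟨hp, hq⟩
      · exact Or.inr ⟨hp, hq⟩
      · exact absurd (by rw [hp, hq]; exact hdiag j) hpq
    exact finrank_le_six_of_common_line_pair u a b c hu ha hb hc i j hij huij hoff hab hac W hWs hWd hWc

/-- ★★★★ **`CaptureIneqSym` for three 2-planes through any common line** (`6 ≤ Σ finrank`; e.g. three genuine planes). [folklore] -/
theorem captureIneqSym_of_common_line (u a b c : Fin 5 → Fin 5 → ℂ) (hu : ∀ p q, u p q = u q p)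
    (ha : ∀ p q, a p q = a q p) (hb : ∀ p q, b p q = b q p) (hc : ∀ p q, c p q = c q p) (hu0 : u ≠ 0)
    (hab : a ∉ Submodule.span ℂ ({u, b} : Set (Fin 5 → Fin 5 → ℂ))) (hac : a ∉ Submodule.span ℂ ({u, c} : Set (Fin 5 → Fin 5 → ℂ)))
    (W : Submodule ℂ (Fin 5 → Fin 5 → ℂ))
    (h6 : 6 ≤ Module.finrank ℂ (Submodule.span ℂ ({u, a} : Set (Fin 5 → Fin 5 → ℂ)))
      + Module.finrank ℂ (Submodule.span ℂ ({u, b} : Set (Fin 5 → Fin 5 → ℂ)))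
      + Module.finrank ℂ (Submodule.span ℂ ({u, c} : Set (Fin 5 → Fin 5 → ℂ))))
    (hWs : ∀ μ ∈ W, ∀ s t : Fin 5, μ s t = μ t s) (hWd : ∀ μ ∈ W, ∀ s : Fin 5, μ s s = 0)
    (hWc : ∀ μ ∈ W, contractZ μ ∈ L3 (Submodule.span ℂ ({u, a} : Set (Fin 5 → Fin 5 → ℂ)))
      (Submodule.span ℂ ({u, b} : Set (Fin 5 → Fin 5 → ℂ))) (Submodule.span ℂ ({u, c} : Set (Fin 5 → Fin 5 → ℂ)))) :
    Module.finrank ℂ W ≤ Module.finrank ℂ (Submodule.span ℂ ({u, a} : Set (Fin 5 → Fin 5 → ℂ)))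
      + Module.finrank ℂ (Submodule.span ℂ ({u, b} : Set (Fin 5 → Fin 5 → ℂ)))
      + Module.finrank ℂ (Submodule.span ℂ ({u, c} : Set (Fin 5 → Fin 5 → ℂ))) :=
  (finrank_le_six_of_common_line u a b c hu ha hb hc hu0 hab hac W hWs hWd hWc).trans h6


/-- ★★★★ **`CaptureIneqSym` FOR THREE PLANES SHARING A LINE (submodule form).**  `P, Q, R` symmetric of finrank ≤ 2 with
`P ⊓ Q ⊓ R ≠ ⊥`, `P ≰ Q`, `P ≰ R`, and finranks adding up to at least 6 (three genuine planes): every `W` of symmetric zero-diagonal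
leaf matrices captured by `L3 P Q R` has `finrank W ≤ finrank P + finrank Q + finrank R`. [folklore] -/
theorem captureIneqSym_of_common_line_planes (P Q R W : Submodule ℂ (Fin 5 → Fin 5 → ℂ))
    (hPs : ∀ x ∈ P, ∀ p q : Fin 5, x p q = x q p) (hQs : ∀ x ∈ Q, ∀ p q : Fin 5, x p q = x q p)
    (hRs : ∀ x ∈ R, ∀ p q : Fin 5, x p q = x q p)
    (hP2 : Module.finrank ℂ P ≤ 2) (hQ2 : Module.finrank ℂ Q ≤ 2) (hR2 : Module.finrank ℂ R ≤ 2)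
    (hline : P ⊓ Q ⊓ R ≠ ⊥) (hPQ : ¬ P ≤ Q) (hPR : ¬ P ≤ R)
    (h6 : 6 ≤ Module.finrank ℂ P + Module.finrank ℂ Q + Module.finrank ℂ R)
    (hWs : ∀ μ ∈ W, ∀ s t : Fin 5, μ s t = μ t s) (hWd : ∀ μ ∈ W, ∀ s : Fin 5, μ s s = 0)
    (hWc : ∀ μ ∈ W, contractZ μ ∈ L3 P Q R) :
    Module.finrank ℂ W ≤ Module.finrank ℂ P + Module.finrank ℂ Q + Module.finrank ℂ R := by
  classical
  obtain ⟨u, huPQR, hu0⟩ := Submodule.exists_mem_ne_zero_of_ne_bot hline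
  obtain ⟨huPQ, huR⟩ := Submodule.mem_inf.mp huPQR
  obtain ⟨huP, huQ⟩ := Submodule.mem_inf.mp huPQ
  obtain ⟨a, haP, haQ⟩ := SetLike.not_le_iff_exists.mp hPQ
  have hu : ∀ p q, u p q = u q p := hPs u huP
  have ha : ∀ p q, a p q = a q p := hPs a haP
  -- `P = ⟨u, a⟩`
  have hPeq : P = Submodule.span ℂ ({u, a} : Set (Fin 5 → Fin 5 → ℂ)) := by
    refine eq_span_pair_of_finrank_le_two P hP2 u a huP haP fun s t hst => ?_
    by_cases ht : t = 0
    · rw [ht, zero_smul, add_zero] at hst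
      exact ⟨(smul_eq_zero.mp hst).resolve_right hu0, ht⟩
    · exfalso
      apply haQ
      have e : a = (-(s / t)) • u := by
        have h2 : t • a = -(s • u) := eq_neg_of_add_eq_zero_right hst
        calc a = t⁻¹ • (t • a) := by rw [smul_smul, inv_mul_cancel₀ ht, one_smul]
          _ = (-(s / t)) • u := by rw [h2, smul_neg, smul_smul, neg_smul, div_eq_inv_mul]
      rw [e]
      exact Q.smul_mem _ huQ
  have haR : a ∉ R := fun haR' => hPR (by
    rw [hPeq, Submodule.span_le]
    intro x hx
    rcases hx with rfl | rfl
    · exact huR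
    · exact haR')
  -- `Q = ⟨u, b⟩`, `R = ⟨u, c⟩` for suitable generators
  have hgen : ∀ V : Submodule ℂ (Fin 5 → Fin 5 → ℂ), Module.finrank ℂ V ≤ 2 → u ∈ V →
      ∃ v : Fin 5 → Fin 5 → ℂ, v ∈ V ∧ V = Submodule.span ℂ ({u, v} : Set (Fin 5 → Fin 5 → ℂ)) := by
    intro V hV2 huV
    by_cases hVu : V ≤ Submodule.span ℂ ({u} : Set (Fin 5 → Fin 5 → ℂ))
    · refine ⟨u, huV, le_antisymm (hVu.trans (Submodule.span_mono (by simp))) ?_⟩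
      rw [Submodule.span_le]
      intro x hx
      rcases hx with rfl | rfl <;> exact huV
    · obtain ⟨v, hvV, hvu⟩ := SetLike.not_le_iff_exists.mp hVu
      refine ⟨v, hvV, eq_span_pair_of_finrank_le_two V hV2 u v huV hvV fun s t hst => ?_⟩
      by_cases ht : t = 0
      · rw [ht, zero_smul, add_zero] at hst
        exact ⟨(smul_eq_zero.mp hst).resolve_right hu0, ht⟩
      · exfalso
        apply hvu
        have e : v = (-(s / t)) • u := by
          have h2 : t • v = -(s • u) := eq_neg_of_add_eq_zero_right hst
          calc v = t⁻¹ • (t • v) := by rw [smul_smul, inv_mul_cancel₀ ht, one_smul]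
            _ = (-(s / t)) • u := by rw [h2, smul_neg, smul_smul, neg_smul, div_eq_inv_mul]
        rw [e]
        exact Submodule.smul_mem _ _ (Submodule.subset_span rfl)
  obtain ⟨b, hbQ, hQeq⟩ := hgen Q hQ2 huQ
  obtain ⟨c, hcR, hReq⟩ := hgen R hR2 huR
  have hb : ∀ p q, b p q = b q p := hQs b hbQ
  have hc : ∀ p q, c p q = c q p := hRs c hcR
  have haQ' : a ∉ Submodule.span ℂ ({u, b} : Set (Fin 5 → Fin 5 → ℂ)) := by rw [← hQeq]; exact haQ
  have haR' : a ∉ Submodule.span ℂ ({u, c} : Set (Fin 5 → Fin 5 → ℂ)) := by rw [← hReq]; exact haR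
  have hWc' : ∀ μ ∈ W, contractZ μ ∈ L3 (Submodule.span ℂ ({u, a} : Set (Fin 5 → Fin 5 → ℂ)))
      (Submodule.span ℂ ({u, b} : Set (Fin 5 → Fin 5 → ℂ))) (Submodule.span ℂ ({u, c} : Set (Fin 5 → Fin 5 → ℂ))) := by
    intro μ hμ
    have h := hWc μ hμ
    rw [hPeq, hQeq, hReq] at h
    exact h
  exact (finrank_le_six_of_common_line u a b c hu ha hb hc hu0 haQ' haR' W hWs hWd hWc').trans h6


/-- ★★★ **K1 ON `K₃ ⊔ K₂ = {01, 02, 12, 34}` FOR THREE SHORT-SPAN PLANES SHARING A LINE**: the short spans on `{0,1}`, `{0,2}`, `{1,2}`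
have finrank ≤ 2 adding up to ≥ 6, meet in a nonzero common element, and the first is contained in neither of the others ⇒ Laplace
weight `≥ 5! = 120` (✓ `sideSym_K32canon_of_captureAt` + ✓ `captureIneqSym_of_common_line_planes`). [folklore] -/
theorem sideSym_K32canon_common_line {N : ℕ} (T : Finset (Fin N)) (S : Fin N → Finset (Fin 5))
    (u w : Fin N → (Fin 5 → Fin 5) → ℂ) (hdec : IsSplitDecomposition T S u w) (hsym : SideSymmetric T S u w)
    (hC : ∀ t ∈ T, S t = ({0, 1} : Finset (Fin 5)) ∨ S t = ({0, 2} : Finset (Fin 5)) ∨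
      S t = ({1, 2} : Finset (Fin 5)) ∨ S t = ({3, 4} : Finset (Fin 5)))
    (h01 : Module.finrank ℂ (shortSpan T S u 0 1) ≤ 2) (h02 : Module.finrank ℂ (shortSpan T S u 0 2) ≤ 2)
    (h12 : Module.finrank ℂ (shortSpan T S u 1 2) ≤ 2)
    (hline : shortSpan T S u 0 1 ⊓ shortSpan T S u 0 2 ⊓ shortSpan T S u 1 2 ≠ ⊥)
    (hn02 : ¬ shortSpan T S u 0 1 ≤ shortSpan T S u 0 2) (hn12 : ¬ shortSpan T S u 0 1 ≤ shortSpan T S u 1 2)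
    (h6 : 6 ≤ Module.finrank ℂ (shortSpan T S u 0 1) + Module.finrank ℂ (shortSpan T S u 0 2)
      + Module.finrank ℂ (shortSpan T S u 1 2)) :
    Nat.factorial 5 ≤ laplaceWeight T S :=
  sideSym_K32canon_of_captureAt T S u w hdec hsym hC fun hs01 hs02 hs12 W hWs hWd hWc =>
    captureIneqSym_of_common_line_planes _ _ _ W hs01 hs02 hs12 h01 h02 h12 hline hn02 hn12 h6 hWs hWd hWc

end LaplaceFiveSeparatedCapture

end Summit.ValiantsHypothesis.ValiantsHypothesis.Theorems.RigidityForcesSymmetryRankRigidMinimalRepr
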